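import Literature.NumberTheory.EllipticCurves.LFunctionPrimeCoeff
import Literature.NumberTheory.EllipticCurves.AnalyticRankLSeriesSummableProofs
import Literature.NumberTheory.DiophantineGeometry.LocalReductionFiniteBadPlacesProofs
import Literature.NumberTheory.LFunctions.PartialEulerProducts
import Mathlib.NumberTheory.EulerProduct.Basic
import Mathlib.Analysis.Complex.Polynomial.Basic
import HarnessLib

/-!
# `L(E, s)` as an Euler product over the rational primes, in Conrad's normalized form

Topic `Literature/NumberTheory/EllipticCurves` (trunk T-ELLARITH). Third layer of the
decomposition of the BSD fact `Literature.NumberTheory.EllipticCurves.analyticRank_eq_of_isEquivalent_prod` (Goldfeld 1982;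
K. Conrad, *Partial Euler products on the critical line*, Canad. J. Math. **57** (2005),
Cor. 5.7: "Apply … Theorem 5.3 to `L(s) = L(E, s + 1/2)`"): the passage from Mathlib's
`WeierstrassCurve.LSeries W` (the Dirichlet series of the formal Euler product
`WeierstrassCurve.LFunction W` over the finite places of `𝓞 ℚ`) to a *normalized Euler product
of degree `≤ 2` over `ℚ`* in the sense of `Literature.NumberTheory.LFunctions.PartialEulerProducts`
(Conrad §2, (2.1)), for an elliptic curve over `ℚ` given by a globally minimal equation `W`.

Main result (`WeierstrassCurve.exists_eulerDatum`, no new definitions): there is a datum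
`α : ℕ → Fin 2 → ℂ` with `|α_{p,j}| ≤ 1` (Conrad's `α_{p,1}, α_{p,2}` of `L(E, s + 1/2)`) such that

* for `Re s > 1` the partial Euler products `∏_{p ≤ x} ∏_j (1 - α_{p,j} p^{-s})⁻¹` tend to
  `W.LSeries (s + 1/2)` as `x → ∞` (Silverman, *AEC* App. C §16: `L_E(s) = ∏_p L_p(p^{-s})⁻¹`
  converges for `Re s > 3/2`);
* for every prime `p`, `∏_j (1 - α_{p,j} p^{-1/2}) = L_p(1/p)` is a positive real number `t_p`
  and `∑_j -log(1 - α_{p,j} p^{-1/2}) = -log t_p`;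
* `t_p = N_p / p`, `N_p = W.reductionPointCount p`, for all `p` outside a finite set (the primes
  of bad reduction; Conrad p. 267: "`#E_ns(𝔽_p)/p` equals the reciprocal of the `p`-th local Euler
  factor in `L(E, s)`, at `s = 1`" — at the good primes this is the definition of `a_p`).

Ingredients, all proved here or in the tree:

* the local polynomial `L_p(T)` of Mathlib (`WeierstrassCurve.localPolynomial` at the place `v`
  over `p`, computed on the chosen local minimal model) is `1 - A_p T + B_p T²` with
  `(A_p, B_p) = (p + 1 - N_p, p)` at a good prime (`natCard_point_reduction_minimal_baseChange`
  of `LFunctionPrimeCoeff`: the local and the global minimal model have the same number of points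
  mod `p`) and `(±1, 0)`, `(0, 0)` at a bad prime (`exists_localPolynomial_eq`);
* Hasse's bound `A_p² ≤ 4p` at a good prime (`sq_le_four_mul_of_hasGoodReductionAt`): for
  `p ≥ 5` from the elementary Hasse theorem `WeierstrassCurve.abs_natCard_point_sub_le_of_ringChar_ne`
  (`HasseElementary`), for `p = 2, 3` from the trivial bound `1 ≤ N_p ≤ 2p + 1`;
* the roots `β_{p,1}, β_{p,2}` of `X² - A_p X + B_p` have `|β_{p,j}|² ≤ p` (`= p` in the good
  case), so `α_{p,j} = β_{p,j} p^{-1/2}` is normalized (`norm_sq_eq_of_quadratic_root`);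
* `W.LFunction` is multiplicative (an Euler product of factors `φ_p(p^{-s})`, `p` prime) with
  `W.LFunction (p^e) = [T^e] (1/L_p)` (`LFunction_apply_prime_pow`), so Mathlib's
  `EulerProduct.eulerProduct` and the absolute convergence for `Re s > 3/2`
  (`LSeriesSummable_of_lt_re_holds`) give `∏_{p<n} ∑_e a_{p^e} p^{-es} → L(E, s)`, and
  `∑_e [T^e](1/L_p) T^e = L_p(T)⁻¹` at `T = p^{-s}` (Cauchy product with `L_p · (1/L_p) = 1`);
* finiteness of the bad primes (`finite_badPlaces_holds`).

Twins (review of p9227): `Literature.NumberTheory.EllipticCurves.BSDGoldfeld.isMultiplicative_LFunction` is statement-identical to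
`WeierstrassCurve.isMultiplicative_LFunction` of
`Literature.NumberTheory.EllipticCurves.ModularityVersionAp` (l. 293); `LFunction_apply_prime_pow`
is the place-to-prime re-indexing (`v := primesEquiv.symm ⟨p, hp⟩`) of
`WeierstrassCurve.LFunction_apply_prime_pow` there (l. 192); `finsetProd_apply_prime_pow` /
`eulerProduct_apply_prime_pow` are a third copy of the generic one-factor lemma
`ArithmeticFunction.eulerProduct_apply_eq_apply` of
`Literature.NumberTheory.EllipticCurves.PAdicLFunctionNeZeroProofs` (l. 165), already copied as
`eulerProduct_apply_eq_of_forall_ne_dvd` in `ModularityVersionAp` (l. 164). Those two files are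
not imported here (modular-form, resp. `p`-adic, import cones).

refactor: (librarian) hoist `isMultiplicative_LFunction`, the place-indexed
`LFunction_apply_prime_pow` and the generic one-factor Euler-product lemma into the common base
`Literature.NumberTheory.EllipticCurves.LFunctionPrimeCoeff` (imported by all three files), then
retire the copies here, in `ModularityVersionAp` and in `PAdicLFunctionNeZeroProofs`.

## References

* K. Conrad, *Partial Euler products on the critical line*, Canad. J. Math. 57 (2005), p. 267,
  §2 (2.1), Cor. 5.7. [cite: Conrad2005PartialEuler]
* J. H. Silverman, *The Arithmetic of Elliptic Curves*, 2nd ed., GTM 106 (2009), App. C §16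
  (definition of `L_v(T)` and `L_E(s)`, convergence for `Re s > 3/2`), Thm. V.1.1 (Hasse).
  [cite: SilvermanAEC2009]
-/

noncomputable section

open scoped Topology
open Filter Finset Complex Polynomial ArithmeticFunction IsDedekindDomain NumberField
  Rat.HeightOneSpectrum

namespace Literature.NumberTheory.EllipticCurves

namespace BSDGoldfeld

/-! ### Arithmetic functions: the value of an Euler product at a prime power -/

/-- The value at a prime power `p^e` of a finite product of normalised arithmetic functions all
but one of which (`F i₀`) vanish at the powers `p^k`, `k ≥ 1`: it is `F i₀ (p^e)` if `i₀` is a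
factor and `1 (p^e)` otherwise. Third local copy (prime-power special case) of the generic
one-factor lemma `ArithmeticFunction.eulerProduct_apply_eq_apply` of
`Literature.NumberTheory.EllipticCurves.PAdicLFunctionNeZeroProofs` /
`ArithmeticFunction.finsetProd_apply_eq_of_forall_ne_dvd` of
`Literature.NumberTheory.EllipticCurves.ModularityVersionAp` (not imported, see the module
docstring; to be hoisted). [folklore] -/
theorem finsetProd_apply_prime_pow {ι R : Type*} [CommSemiring R] [DecidableEq ι]
    (F : ι → ArithmeticFunction R) (h1 : ∀ i, F i 1 = 1) {p : ℕ} (hp : p.Prime) (i₀ : ι)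
    (hvan : ∀ i, i ≠ i₀ → ∀ k, k ≠ 0 → F i (p ^ k) = 0) (s : Finset ι) (e : ℕ) :
    (∏ i ∈ s, F i) (p ^ e) =
      if i₀ ∈ s then F i₀ (p ^ e) else (1 : ArithmeticFunction R) (p ^ e) := by
  induction s using Finset.induction_on generalizing e with
  | empty => simp
  | insert j s hj ih =>
    rw [Finset.prod_insert hj, mul_apply, Nat.sum_divisorsAntidiagonal fun a b => F j a * (∏ i ∈ s, F i) b,
      Nat.sum_divisors_prime_pow hp]
    have hdiv : ∀ x ∈ Finset.range (e + 1), p ^ e / p ^ x = p ^ (e - x) := fun x hx =>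
      Nat.pow_div (Nat.lt_succ_iff.mp (Finset.mem_range.mp hx)) hp.pos
    rw [Finset.sum_congr rfl fun x hx => by rw [hdiv x hx, ih (e - x)]]
    by_cases hji : j = i₀
    · subst hji
      have hs : j ∉ s := hj
      simp only [Finset.mem_insert, true_or, if_true, if_neg hs]
      rw [Finset.sum_eq_single e]
      · simp
      · intro x hx hxe
        have hlt : x < e := lt_of_le_of_ne (Nat.lt_succ_iff.mp (Finset.mem_range.mp hx)) hxe
        have : p ^ (e - x) ≠ 1 := by
          rw [Ne, pow_eq_one_iff]
          push Not
          exact ⟨hp.ne_one, by omega⟩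
        rw [one_apply_ne this, mul_zero]
      · intro he; exact absurd (Finset.mem_range.mpr (Nat.lt_succ_self e)) he
    · have hmem : (i₀ ∈ insert j s) ↔ i₀ ∈ s := by
        simp [Finset.mem_insert, Ne.symm hji]
      simp only [hmem]
      rw [Finset.sum_eq_single 0]
      · simp [h1 j]
      · intro x _ hx0
        rw [hvan j hji x hx0, zero_mul]
      · intro h0; exact absurd (Finset.mem_range.mpr (Nat.succ_pos e)) h0

/-- **The value of an Euler product at a prime power.** If the `F i` are normalised, converge to
`1` coefficientwise, and all but `F i₀` vanish at `p, p², …`, then `(∏ᵢ F i)(p^e) = F i₀ (p^e)`.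
Twin (prime-power special case) of `ArithmeticFunction.eulerProduct_apply_eq_apply`
(`PAdicLFunctionNeZeroProofs`, l. 165) and `ArithmeticFunction.eulerProduct_apply_eq_of_forall_ne_dvd`
(`ModularityVersionAp`, l. 164), neither imported here (see the module docstring). [folklore] -/
theorem eulerProduct_apply_prime_pow {ι R : Type*} [CommSemiring R] (F : ι → ArithmeticFunction R)
    (hF : ∀ n, ∀ᶠ i in cofinite, F i n = (1 : ArithmeticFunction R) n) (h1 : ∀ i, F i 1 = 1)
    {p : ℕ} (hp : p.Prime) (i₀ : ι) (hvan : ∀ i, i ≠ i₀ → ∀ k, k ≠ 0 → F i (p ^ k) = 0) (e : ℕ) :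
    eulerProduct F (p ^ e) = F i₀ (p ^ e) := by
  classical
  obtain ⟨s, hs, hs'⟩ := ((tendsTo_eulerProduct_of_tendsTo F hF (p ^ e)).and
    (eventually_ge_atTop {i₀})).exists
  rw [← hs, finsetProd_apply_prime_pow F h1 hp i₀ hvan, if_pos (hs' (Finset.mem_singleton_self i₀))]

/-! ### Power series over `ℤ` evaluated at a complex number: the Cauchy product -/

/-- **Cauchy product of evaluated power series.** If `∑ [Tⁿ]φ · zⁿ` and `∑ [Tⁿ]ψ · zⁿ` converge
absolutely, their product is `∑ [Tⁿ](φψ) · zⁿ`. [folklore] -/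
theorem tsum_coeff_mul_pow_mul {φ ψ : PowerSeries ℤ} {z : ℂ}
    (hφ : Summable fun n => ‖((PowerSeries.coeff n φ : ℤ) : ℂ) * z ^ n‖)
    (hψ : Summable fun n => ‖((PowerSeries.coeff n ψ : ℤ) : ℂ) * z ^ n‖) :
    (∑' n, ((PowerSeries.coeff n φ : ℤ) : ℂ) * z ^ n) * (∑' n, ((PowerSeries.coeff n ψ : ℤ) : ℂ) * z ^ n)
      = ∑' n, ((PowerSeries.coeff n (φ * ψ) : ℤ) : ℂ) * z ^ n := by
  rw [tsum_mul_tsum_eq_tsum_sum_antidiagonal_of_summable_norm hφ hψ]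
  refine tsum_congr fun n => ?_
  rw [PowerSeries.coeff_mul, Int.cast_sum, Finset.sum_mul]
  refine Finset.sum_congr rfl fun ij hij => ?_
  have hij' : ij.1 + ij.2 = n := by simpa using hij
  rw [← hij', pow_add]
  push_cast
  ring

/-- A polynomial over `ℤ` evaluated as a (finite) power series:
`∑' n, [Tⁿ]L · zⁿ = ∑_{n ≤ deg L} [Tⁿ]L · zⁿ`, and this series converges absolutely. [folklore] -/
theorem summable_norm_coeff_coe_mul_pow (L : ℤ[X]) (z : ℂ) :
    Summable fun n => ‖((PowerSeries.coeff n (L : PowerSeries ℤ) : ℤ) : ℂ) * z ^ n‖ := by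
  refine summable_of_ne_finset_zero (s := Finset.range (L.natDegree + 1)) fun n hn => ?_
  rw [Finset.mem_range, not_lt] at hn
  rw [Polynomial.coeff_coe, Polynomial.coeff_eq_zero_of_natDegree_lt (by omega)]
  simp

/-! ### The local polynomials of an elliptic curve over `ℚ` -/

variable (W : WeierstrassCurve ℚ)

/-- **Shape of the local polynomial.** At every finite place `v` of `ℚ` (over the prime `p`)
Mathlib's local polynomial of `W / ℚ_v` is `1 - A T + B T²` where, for `W` elliptic and globally
minimal, `(A, B) = (p + 1 - N_p, p)` if `W` has good reduction at `v` (`N_p` the number of points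
mod `p` of the global minimal model, `reductionPointCount`), and `(A, B) ∈ {(1,0), (-1,0), (0,0)}`
(split, nonsplit, additive) otherwise (Silverman, *AEC* App. C §16; the point counts of the local
and global minimal models agree by VII.1.3(b), `natCard_point_reduction_minimal_baseChange`).
[cite: SilvermanAEC2009, App. C §16] -/
theorem exists_localPolynomial_eq [W.IsElliptic] [W.IsGloballyMinimal]
    (v : HeightOneSpectrum (𝓞 ℚ)) :
    ∃ A B : ℤ, (W.baseChange (v.adicCompletion ℚ)).localPolynomial (v.adicCompletionIntegers ℚ) =
        1 - C A * X + C B * X ^ 2 ∧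
      ((W.HasGoodReductionAt v ∧ A = (primesEquiv v : ℕ) + 1 - W.reductionPointCount (primesEquiv v) ∧
          B = (primesEquiv v : ℕ)) ∨
        (¬ W.HasGoodReductionAt v ∧ |A| ≤ 1 ∧ B = 0)) := by
  have hq := WeierstrassCurve.natCard_residueField_adicCompletionIntegers v
  have hN := WeierstrassCurve.natCard_point_reduction_minimal_baseChange v W
  unfold WeierstrassCurve.localPolynomial
  split_ifs with hgood hsplit hmult
  · refine ⟨(primesEquiv v : ℕ) + 1 - W.reductionPointCount (primesEquiv v), (primesEquiv v : ℕ),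
      ?_, Or.inl ⟨hgood, rfl, rfl⟩⟩
    rw [hq, hN]
  · exact ⟨1, 0, by simp, Or.inr ⟨hgood, by norm_num, rfl⟩⟩
  · exact ⟨-1, 0, by simp, Or.inr ⟨hgood, by norm_num, rfl⟩⟩
  · exact ⟨0, 0, by simp, Or.inr ⟨hgood, by norm_num, rfl⟩⟩

/-- **Hasse's bound at a good prime** (Silverman, *AEC* Thm. V.1.1: `|p + 1 - #Ẽ(𝔽_p)| ≤ 2√p`),
in the form `(p + 1 - N_p)² ≤ 4p` for the point count of the global minimal model: for
`p ≥ 5` by the elementary Hasse theorem for the (elliptic) reduction of the local minimal model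
over the residue field with `p` elements (`WeierstrassCurve.abs_natCard_point_sub_le_of_ringChar_ne`),
for `p ∈ {2, 3}` by the trivial bound `1 ≤ N_p ≤ 2p + 1` and `p² ≤ 4p`.
[cite: SilvermanAEC2009, Thm. V.1.1] -/
theorem sq_le_four_mul_of_hasGoodReductionAt [W.IsElliptic] [W.IsGloballyMinimal]
    (v : HeightOneSpectrum (𝓞 ℚ)) (hgood : W.HasGoodReductionAt v) :
    (((primesEquiv v : ℕ) : ℤ) + 1 - W.reductionPointCount (primesEquiv v)) ^ 2 ≤
      4 * ((primesEquiv v : ℕ) : ℤ) := by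
  set R := v.adicCompletionIntegers ℚ with hR
  set p : ℕ := (primesEquiv v : ℕ) with hpdef
  have hp : p.Prime := (primesEquiv v).2
  have hq : Nat.card (IsLocalRing.ResidueField R) = p :=
    WeierstrassCurve.natCard_residueField_adicCompletionIntegers v
  haveI : Finite (IsLocalRing.ResidueField R) := Nat.finite_of_card_ne_zero (by rw [hq]; exact hp.ne_zero)
  letI : Fintype (IsLocalRing.ResidueField R) := Fintype.ofFinite _
  have hcard : Fintype.card (IsLocalRing.ResidueField R) = p := by
    rw [← Nat.card_eq_fintype_card, hq]
  set E := ((W.baseChange (v.adicCompletion ℚ)).minimal R).reduction R with hE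
  haveI : E.IsElliptic := (WeierstrassCurve.hasGoodReduction_iff_isElliptic_reduction R).mp hgood
  have hN : Nat.card E.toAffine.Point = W.reductionPointCount p :=
    WeierstrassCurve.natCard_point_reduction_minimal_baseChange v W
  by_cases h5 : 5 ≤ p
  · -- `p ≥ 5`: the residue field has characteristic `p ≠ 2, 3`
    have hchar : ringChar (IsLocalRing.ResidueField R) = p := by
      haveI := Fact.mk hp
      haveI : CharP (IsLocalRing.ResidueField R) p := charP_of_card_eq_prime hcard
      exact ringChar.eq _ p
    have hH := E.abs_natCard_point_sub_le_of_ringChar_ne (by rw [hchar]; omega) (by rw [hchar]; omega)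
    rw [hcard, hN] at hH
    -- square the real inequality
    have hsq : ((W.reductionPointCount p : ℝ) - (p + 1)) ^ 2 ≤ 4 * p := by
      have h0 : 0 ≤ 2 * Real.sqrt p := by positivity
      have := abs_le.mp hH
      have hs : Real.sqrt (p : ℝ) ^ 2 = p := Real.sq_sqrt (Nat.cast_nonneg p)
      nlinarith [abs_nonneg ((W.reductionPointCount p : ℝ) - (p + 1)), sq_abs ((W.reductionPointCount p : ℝ) - (p + 1))]
    have : (((p : ℤ) + 1 - W.reductionPointCount p) ^ 2 : ℤ) ≤ 4 * (p : ℤ) := by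
      have h' : (((p : ℤ) + 1 - W.reductionPointCount p : ℤ) : ℝ) ^ 2 ≤ 4 * (p : ℝ) := by
        push_cast
        nlinarith [hsq]
      exact_mod_cast h'
    exact this
  · -- `p ∈ {2, 3}`: trivial bound
    have hp3 : p ≤ 4 := by omega
    have htriv := E.abs_card_add_one_sub_natCard_point_le
    rw [hcard, hN] at htriv
    have hab := abs_le.mp htriv
    have hp4 : (p : ℤ) ≤ 4 := by exact_mod_cast hp3
    have hp0 : (0 : ℤ) ≤ p := by positivity
    nlinarith [hab.1, hab.2, sq_abs ((p : ℤ) + 1 - W.reductionPointCount p), abs_nonneg ((p : ℤ) + 1 - W.reductionPointCount p)]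

/-! ### Roots of the local polynomial -/

/-- A monic complex quadratic `X² - A X + B` factors: there are `β₁, β₂` with `β₁ + β₂ = A`,
`β₁ β₂ = B` (via a square root of the discriminant, `IsAlgClosed.exists_pow_nat_eq`). [folklore] -/
theorem exists_add_eq_mul_eq (A B : ℂ) : ∃ β₁ β₂ : ℂ, β₁ + β₂ = A ∧ β₁ * β₂ = B := by
  obtain ⟨D, hD⟩ := IsAlgClosed.exists_pow_nat_eq (A ^ 2 - 4 * B) (by norm_num : 0 < 2)
  refine ⟨(A + D) / 2, (A - D) / 2, by ring, ?_⟩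
  linear_combination (-(1 : ℂ) / 4) * hD

/-- **Modulus of the roots under Hasse's condition.** If `A, B` are real with `A² ≤ 4B` and
`z² - A z + B = 0`, then `|z|² = B` (the roots are complex conjugate, or a real double root).
[folklore] -/
theorem norm_sq_eq_of_quadratic_root {A B : ℝ} (h : A ^ 2 ≤ 4 * B) {z : ℂ}
    (hz : z ^ 2 - A * z + B = 0) : ‖z‖ ^ 2 = B := by
  have h := hz
  rw [Complex.ext_iff] at h
  simp [pow_two] at h
  obtain ⟨hre0, him0⟩ := h
  have hre : z.re * z.re - z.im * z.im - A * z.re + B = 0 := by linarith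
  rw [Complex.sq_norm, Complex.normSq_apply]
  -- `im`-part: `y (2x - A) = 0`
  have him' : z.im * (2 * z.re - A) = 0 := by linarith
  rcases mul_eq_zero.mp him' with hy | hx
  · -- real root: then `A² = 4B` and `x = A/2`
    rw [hy, mul_zero, sub_zero] at hre
    have hdisc : (2 * z.re - A) ^ 2 = A ^ 2 - 4 * B := by nlinarith
    have h0 : A ^ 2 - 4 * B = 0 := by nlinarith [sq_nonneg (2 * z.re - A)]
    have hx : z.re = A / 2 := by nlinarith [sq_nonneg (2 * z.re - A)]
    rw [hy, hx]
    nlinarith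
  · have hx : z.re = A / 2 := by linarith
    rw [hx] at hre ⊢
    nlinarith

/-- If `|A| ≤ 1` and `z² - A z = 0` then `|z| ≤ 1` (`z ∈ {0, A}`). [folklore] -/
theorem norm_le_one_of_quadratic_root {A : ℝ} (hA : |A| ≤ 1) {z : ℂ} (hz : z ^ 2 - A * z = 0) :
    ‖z‖ ≤ 1 := by
  have : z * (z - A) = 0 := by linear_combination hz
  rcases mul_eq_zero.mp this with h | h
  · rw [h, norm_zero]; exact zero_le_one
  · rw [sub_eq_zero.mp h, norm_real, Real.norm_eq_abs]; exact hA

/-! ### The coefficients of `L(E, s)` at prime powers -/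

/-- The local Euler factor at a place `w` not over `p` vanishes at `p^k`, `k ≥ 1` (it is supported
on the powers of its own residue characteristic). [folklore] -/
theorem localEulerFactor_apply_prime_pow_eq_zero {p : ℕ} (hp : p.Prime)
    (w : HeightOneSpectrum (𝓞 ℚ)) (hw : (primesEquiv w : ℕ) ≠ p) {k : ℕ} (hk : k ≠ 0) :
    (W.baseChange (w.adicCompletion ℚ)).localEulerFactor (w.adicCompletionIntegers ℚ) (p ^ k) = 0 := by
  have hq := WeierstrassCurve.natCard_residueField_adicCompletionIntegers w
  have hq1 : 1 < Nat.card (IsLocalRing.ResidueField (w.adicCompletionIntegers ℚ)) := by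
    rw [hq]; exact (primesEquiv w).2.one_lt
  rw [WeierstrassCurve.localEulerFactor, ofPowerSeries_apply hq1, Function.extend_apply', Pi.zero_apply]
  rintro ⟨a, ha⟩
  rw [hq] at ha
  -- `q ^ a = p ^ k` with `k ≥ 1`: then `p ∣ q`, so `p = q`
  have hdvd : p ∣ (primesEquiv w : ℕ) ^ a := by rw [ha]; exact dvd_pow_self p hk
  have h1 : p ∣ (primesEquiv w : ℕ) := hp.dvd_of_dvd_pow hdvd
  exact hw ((Nat.prime_dvd_prime_iff_eq hp (primesEquiv w).2).mp h1).symm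

/-- **The coefficient of `L(E, s)` at a prime power** is the corresponding coefficient of the
inverted local factor `1/L_p(T)` at the place over `p`: `a_{p^e} = [T^e](1/L_p)`
(Silverman, *AEC* App. C §16, `L_E(s) = ∏_p L_p(p^{-s})⁻¹`; here for Mathlib's formal Euler
product `WeierstrassCurve.LFunction` over the places of `𝓞 ℚ`). Twin: the place-to-prime
re-indexing (`v := primesEquiv.symm ⟨p, hp⟩`) of `WeierstrassCurve.LFunction_apply_prime_pow`
of `Literature.NumberTheory.EllipticCurves.ModularityVersionAp` (l. 192; not imported, see the
module docstring). [cite: SilvermanAEC2009, App. C §16] -/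
theorem LFunction_apply_prime_pow {p : ℕ} (hp : p.Prime) (e : ℕ) :
    W.LFunction (p ^ e) = PowerSeries.coeff e
      ((W.baseChange (((primesEquiv (R := 𝓞 ℚ)).symm ⟨p, hp⟩).adicCompletion ℚ)).localPowerSeries
        (((primesEquiv (R := 𝓞 ℚ)).symm ⟨p, hp⟩).adicCompletionIntegers ℚ)) := by
  set v : HeightOneSpectrum (𝓞 ℚ) := (primesEquiv (R := 𝓞 ℚ)).symm ⟨p, hp⟩ with hv
  have hvp : (primesEquiv v : ℕ) = p := by rw [hv, Equiv.apply_symm_apply]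
  rw [WeierstrassCurve.LFunction_eq_eulerProduct]
  rw [eulerProduct_apply_prime_pow _ W.eventually_cofinite_localEulerFactor_apply
    (fun w => WeierstrassCurve.localEulerFactor_apply_one _ _) hp v ?_ e]
  · have hq := WeierstrassCurve.natCard_residueField_adicCompletionIntegers v
    rw [hvp] at hq
    rw [WeierstrassCurve.localEulerFactor, hq, ofPowerSeries_apply_pow hp.one_lt]
  · intro w hw k hk
    refine localEulerFactor_apply_prime_pow_eq_zero W hp w ?_ hk
    intro h
    apply hw
    apply primesEquiv.injective
    exact Subtype.ext (by rw [h, hvp])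

/-- **`L(E, s)` is multiplicative** over `ℚ`: an Euler product of factors `φ_v(q_v^{-s})` with
`q_v = p` prime (Silverman, *AEC* App. C §16). Statement-identical local copy of
`WeierstrassCurve.isMultiplicative_LFunction` of
`Literature.NumberTheory.EllipticCurves.ModularityVersionAp` (l. 293; not imported — modular-form
import cone — see the module docstring; to be hoisted into `LFunctionPrimeCoeff`).
[cite: SilvermanAEC2009, App. C §16] -/
theorem isMultiplicative_LFunction : W.LFunction.IsMultiplicative := by
  rw [WeierstrassCurve.LFunction_eq_eulerProduct]
  refine isMultiplicative_eulerProduct _ fun v => ?_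
  rw [WeierstrassCurve.localEulerFactor, WeierstrassCurve.natCard_residueField_adicCompletionIntegers v]
  exact isMultiplicative_ofPowerSeries_of_isPrimePow _ (primesEquiv v).2.isPrimePow _
    (WeierstrassCurve.constantCoeff_localPowerSeries _ _)

/-! ### The local factor of `L(E, s)` summed: `∑_e a_{p^e} p^{-es} = L_p(p^{-s})⁻¹` -/

/-- **The `p`-part of `L(E, s)`.** For `Re s > 3/2` and a prime `p` with local polynomial
`L_p = 1 - A T + B T²`, the subseries of `L(E, s) = ∑ aₙ n^{-s}` over the powers of `p`
converges to `L_p(p^{-s})⁻¹ = (1 - A p^{-s} + B p^{-2s})⁻¹` (Silverman, *AEC* App. C §16).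
[cite: SilvermanAEC2009, App. C §16] -/
theorem hasSum_term_prime_pow {p : ℕ} (hp : p.Prime) {A B : ℤ}
    (hL : (W.baseChange (((primesEquiv (R := 𝓞 ℚ)).symm ⟨p, hp⟩).adicCompletion ℚ)).localPolynomial
        (((primesEquiv (R := 𝓞 ℚ)).symm ⟨p, hp⟩).adicCompletionIntegers ℚ) = 1 - C A * X + C B * X ^ 2)
    {s : ℂ} (hs : (3 / 2 : ℝ) < s.re) :
    HasSum (fun e : ℕ => LSeries.term (fun n => (W.LFunction n : ℂ)) s (p ^ e))
      (1 - A * (p : ℂ) ^ (-s) + B * ((p : ℂ) ^ (-s)) ^ 2)⁻¹ := by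
  set v : HeightOneSpectrum (𝓞 ℚ) := (primesEquiv (R := 𝓞 ℚ)).symm ⟨p, hp⟩ with hv
  set R := v.adicCompletionIntegers ℚ
  set φ := (W.baseChange (v.adicCompletion ℚ)).localPowerSeries R with hφ
  set T : ℂ := (p : ℂ) ^ (-s) with hT
  -- the terms at the powers of `p`
  have hf0 : (fun n => (W.LFunction n : ℂ)) 0 = 0 := by simp
  have hterm : ∀ e : ℕ, LSeries.term (fun n => (W.LFunction n : ℂ)) s (p ^ e) =
      ((PowerSeries.coeff e φ : ℤ) : ℂ) * T ^ e := by
    intro e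
    rw [LSeries.term_def₀ hf0, LFunction_apply_prime_pow W hp e, hT, ← cpow_nat_mul, Nat.cast_pow,
      natCast_cpow_natCast_mul]
  -- absolute convergence of the `p`-part, from that of `L(E, s)`
  have hsumall : Summable fun n => ‖LSeries.term (fun n => (W.LFunction n : ℂ)) s n‖ :=
    (W.LSeriesSummable_of_lt_re_holds hs).norm
  have hsumφ : Summable fun e => ‖((PowerSeries.coeff e φ : ℤ) : ℂ) * T ^ e‖ := by
    have := hsumall.comp_injective (Nat.pow_right_injective hp.two_le)
    refine this.congr fun e => ?_
    simp only [Function.comp_apply, hterm]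
  -- `L · φ = 1`, evaluated at `T`
  have hLφ : ((1 - C A * X + C B * X ^ 2 : ℤ[X]) : PowerSeries ℤ) * φ = 1 := by
    rw [hφ, WeierstrassCurve.localPowerSeries, hL]
    exact PowerSeries.mul_invOfUnit _ _ (by simp)
  have hLeval : ∑' n, ((PowerSeries.coeff n ((1 - C A * X + C B * X ^ 2 : ℤ[X]) : PowerSeries ℤ) : ℤ) : ℂ) *
      T ^ n = 1 - A * T + B * T ^ 2 := by
    rw [tsum_eq_sum (s := Finset.range 3)]
    · simp only [Polynomial.coeff_coe]
      simp [Finset.sum_range_succ, coeff_one, coeff_X]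
      ring
    · intro n hn
      rw [Finset.mem_range, not_lt] at hn
      rw [Polynomial.coeff_coe]
      have : (1 - C A * X + C B * X ^ 2 : ℤ[X]).coeff n = 0 := by
        simp [coeff_one, coeff_X]
        omega
      rw [this]; simp
  have hprod := tsum_coeff_mul_pow_mul (summable_norm_coeff_coe_mul_pow (1 - C A * X + C B * X ^ 2) T) hsumφ
  rw [hLφ, hLeval] at hprod
  have hone : ∑' n, ((PowerSeries.coeff n (1 : PowerSeries ℤ) : ℤ) : ℂ) * T ^ n = 1 := by
    rw [tsum_eq_single 0]
    · simp
    · intro n hn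
      rw [PowerSeries.coeff_one, if_neg hn]; simp
  rw [hone] at hprod
  -- conclude
  have hval : ∑' e, ((PowerSeries.coeff e φ : ℤ) : ℂ) * T ^ e = (1 - A * T + B * T ^ 2)⁻¹ :=
    (eq_inv_of_mul_eq_one_right hprod)
  have hs' : HasSum (fun e => ((PowerSeries.coeff e φ : ℤ) : ℂ) * T ^ e) (1 - A * T + B * T ^ 2)⁻¹ := by
    rw [← hval]
    exact hsumφ.of_norm.hasSum
  exact hs'.congr_fun hterm

/-! ### The normalized datum of `L(E, s + 1/2)` -/

/-- **Local data at a prime.** For every prime `p` there are `A, B ∈ ℤ` and `β₁, β₂ ∈ ℂ` with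
`L_p(T) = 1 - AT + BT² = (1 - β₁T)(1 - β₂T)`, `|β_j|² ≤ p`, the `p`-part of `L(E, s)` equal to
`L_p(p^{-s})⁻¹` for `Re s > 3/2`, `L_p(1/p) > 0`, and `L_p(1/p) = N_p/p` if `p` is good
(Silverman, *AEC* App. C §16 with Thm. V.1.1; Conrad p. 267). [cite: SilvermanAEC2009, App. C §16] -/
theorem exists_local_data [W.IsElliptic] [W.IsGloballyMinimal] {p : ℕ} (hp : p.Prime) :
    ∃ (A B : ℤ) (β₁ β₂ : ℂ), β₁ + β₂ = A ∧ β₁ * β₂ = B ∧ ‖β₁‖ ^ 2 ≤ p ∧ ‖β₂‖ ^ 2 ≤ p ∧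
      (∀ s : ℂ, (3 / 2 : ℝ) < s.re →
        HasSum (fun e : ℕ => LSeries.term (fun n => (W.LFunction n : ℂ)) s (p ^ e))
          (1 - A * (p : ℂ) ^ (-s) + B * ((p : ℂ) ^ (-s)) ^ 2)⁻¹) ∧
      0 < 1 - (A : ℝ) / p + B / (p : ℝ) ^ 2 ∧
      (W.HasGoodReductionAt ((primesEquiv (R := 𝓞 ℚ)).symm ⟨p, hp⟩) →
        1 - (A : ℝ) / p + B / (p : ℝ) ^ 2 = W.reductionPointCount p / p) := by
  set v : HeightOneSpectrum (𝓞 ℚ) := (primesEquiv (R := 𝓞 ℚ)).symm ⟨p, hp⟩ with hv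
  have hvp : (primesEquiv v : ℕ) = p := by rw [hv, Equiv.apply_symm_apply]
  obtain ⟨A, B, hL, hcase⟩ := exists_localPolynomial_eq W v
  obtain ⟨β₁, β₂, hsum, hprod⟩ := exists_add_eq_mul_eq (A : ℂ) (B : ℂ)
  have hp0 : (0 : ℝ) < p := by exact_mod_cast hp.pos
  have hp2 : (2 : ℝ) ≤ p := by exact_mod_cast hp.two_le
  -- both `β`'s are roots of `z² - Az + B`
  have hroot1 : β₁ ^ 2 - (A : ℂ) * β₁ + B = 0 := by
    have : β₂ = A - β₁ := by linear_combination hsum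
    rw [this] at hprod; linear_combination -hprod
  have hroot2 : β₂ ^ 2 - (A : ℂ) * β₂ + B = 0 := by
    have : β₁ = A - β₂ := by linear_combination hsum
    rw [this] at hprod; linear_combination -hprod
  refine ⟨A, B, β₁, β₂, hsum, hprod, ?_, ?_, fun s hs => hasSum_term_prime_pow W hp hL hs, ?_, ?_⟩
  · -- `‖β₁‖² ≤ p`
    rcases hcase with ⟨hgood, hA, hB⟩ | ⟨hbad, hA, hB⟩
    · have hH := sq_le_four_mul_of_hasGoodReductionAt W v hgood
      rw [hvp] at hH hA hB
      rw [← hA, ← hB] at hH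
      have hH' : (A : ℝ) ^ 2 ≤ 4 * (B : ℝ) := by exact_mod_cast hH
      have := norm_sq_eq_of_quadratic_root hH' (z := β₁) (by exact_mod_cast hroot1)
      rw [this, hB]; push_cast; exact le_rfl
    · subst hB
      have hA' : |(A : ℝ)| ≤ 1 := by exact_mod_cast hA
      have h1 := norm_le_one_of_quadratic_root hA' (z := β₁) (by
        have := hroot1; push_cast at this; simpa using this)
      calc ‖β₁‖ ^ 2 ≤ (1 : ℝ) ^ 2 := by gcongr
        _ = 1 := one_pow 2
        _ ≤ (p : ℝ) := by exact_mod_cast hp.one_lt.le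
  · -- `‖β₂‖² ≤ p`
    rcases hcase with ⟨hgood, hA, hB⟩ | ⟨hbad, hA, hB⟩
    · have hH := sq_le_four_mul_of_hasGoodReductionAt W v hgood
      rw [hvp] at hH hA hB
      rw [← hA, ← hB] at hH
      have hH' : (A : ℝ) ^ 2 ≤ 4 * (B : ℝ) := by exact_mod_cast hH
      have := norm_sq_eq_of_quadratic_root hH' (z := β₂) (by exact_mod_cast hroot2)
      rw [this, hB]; push_cast; exact le_rfl
    · subst hB
      have hA' : |(A : ℝ)| ≤ 1 := by exact_mod_cast hA
      have h1 := norm_le_one_of_quadratic_root hA' (z := β₂) (by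
        have := hroot2; push_cast at this; simpa using this)
      calc ‖β₂‖ ^ 2 ≤ (1 : ℝ) ^ 2 := by gcongr
        _ = 1 := one_pow 2
        _ ≤ (p : ℝ) := by exact_mod_cast hp.one_lt.le
  · -- positivity of `L_p(1/p)`
    rcases hcase with ⟨hgood, hA, hB⟩ | ⟨hbad, hA, hB⟩
    · rw [hvp] at hA hB
      rw [hA, hB]
      have hN : (0 : ℝ) < W.reductionPointCount p := by
        haveI : NeZero p := ⟨hp.ne_zero⟩
        exact_mod_cast W.reductionPointCount_pos p
      have : 1 - ((((p : ℕ) : ℤ) + 1 - (W.reductionPointCount p : ℕ) : ℤ) : ℝ) / p +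
          (((p : ℕ) : ℤ) : ℝ) / (p : ℝ) ^ 2 = W.reductionPointCount p / p := by
        push_cast; field_simp; ring
      rw [this]
      positivity
    · subst hB
      have hA' : |(A : ℝ)| ≤ 1 := by exact_mod_cast hA
      have := abs_le.mp hA'
      have h1 : (A : ℝ) / p ≤ 1 / 2 := by
        rw [div_le_iff₀ hp0]; nlinarith
      push_cast
      rw [zero_div, add_zero]
      linarith
  · -- the good case: `L_p(1/p) = N_p / p`
    intro hgood
    rcases hcase with ⟨-, hA, hB⟩ | ⟨hbad, -, -⟩
    · rw [hvp] at hA hB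
      rw [hA, hB]; push_cast; field_simp; ring
    · exact absurd hgood hbad

end BSDGoldfeld

end Literature.NumberTheory.EllipticCurves

/-! ### The datum, assembled -/

namespace WeierstrassCurve

open Literature.NumberTheory.EllipticCurves.BSDGoldfeld Literature.NumberTheory.LFunctions.PartialEuler IsDedekindDomain NumberField Rat.HeightOneSpectrum Filter Complex

/-- **`L(E, s + 1/2)` as a normalized Euler product of degree `≤ 2` over `ℚ`** (Conrad 2005,
§2 (2.1) and proof of Cor. 5.7; Silverman, *AEC* App. C §16). For an elliptic curve over `ℚ` with
globally minimal equation `W` there is `α : ℕ → Fin 2 → ℂ` with `|α_{p,j}| ≤ 1` such that: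
(i) for `Re s > 1`, `∏_{p ≤ x} ∏_j (1 - α_{p,j} p^{-s})⁻¹ → W.LSeries (s + 1/2)` as `x → ∞`;
(ii) for every prime `p`, `∏_j (1 - α_{p,j} p^{-1/2})` is a positive real `t_p` with
`∑_j -log(1 - α_{p,j} p^{-1/2}) = -log t_p`; (iii) `t_p = N_p / p`
(`N_p = W.reductionPointCount p`) for all primes `p` outside a finite set.
[cite: Conrad2005PartialEuler, §2 (2.1) and Cor. 5.7] -/
theorem exists_eulerDatum (W : WeierstrassCurve ℚ) [W.IsElliptic] [W.IsGloballyMinimal] :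
    ∃ α : ℕ → Fin 2 → ℂ, IsNormalized α ∧
      (∀ s : ℂ, 1 < s.re →
        Tendsto (fun x : ℝ => partialProduct α s x) atTop (𝓝 (W.LSeries (s + 1 / 2)))) ∧
      ∃ t : ℕ → ℝ, (∀ p : ℕ, p.Prime →
          0 < t p ∧ logEulerFactor α (1 / 2) p = -((Real.log (t p) : ℝ) : ℂ)) ∧
        ∃ S : Finset ℕ, ∀ p : ℕ, p.Prime → p ∉ S → t p = W.reductionPointCount p / p := by
  classical
  -- choose the local data at every prime
  have hdata := fun p : Nat.Primes => exists_local_data W p.2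
  choose A B β₁ β₂ hsum hprod hβ₁ hβ₂ hEuler hpos hgoodcase using hdata
  -- the datum: `α_{p,j} = β_{p,j} p^{-1/2}` at primes, `0` elsewhere
  set β : ℕ → Fin 2 → ℂ := fun n j =>
    if hn : n.Prime then (if j = 0 then β₁ ⟨n, hn⟩ else β₂ ⟨n, hn⟩) else 0 with hβ
  set α : ℕ → Fin 2 → ℂ := fun n j => β n j * (n : ℂ) ^ (-(1 / 2 : ℂ)) with hα
  set t : ℕ → ℝ := fun n =>
    if hn : n.Prime then 1 - (A ⟨n, hn⟩ : ℝ) / n + B ⟨n, hn⟩ / (n : ℝ) ^ 2 else 1 with ht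
  have hβnorm : ∀ (p : ℕ) (hp : p.Prime) (j : Fin 2), ‖β p j‖ ^ 2 ≤ p := by
    intro p hp j
    simp only [hβ, dif_pos hp]
    fin_cases j
    · simpa using hβ₁ ⟨p, hp⟩
    · simpa using hβ₂ ⟨p, hp⟩
  -- the Euler factor at a prime, in terms of `A, B`
  have hfactor : ∀ (p : ℕ) (hp : p.Prime) (T : ℂ),
      ∏ j, (1 - β p j * T) = 1 - (A ⟨p, hp⟩ : ℂ) * T + (B ⟨p, hp⟩ : ℂ) * T ^ 2 := by
    intro p hp T
    rw [Fin.prod_univ_two]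
    simp only [hβ, dif_pos hp, Fin.isValue, if_true, show (1 : Fin 2) ≠ 0 from by decide, if_false]
    have h1 := hsum ⟨p, hp⟩
    have h2 := hprod ⟨p, hp⟩
    linear_combination (-T) * h1 + T ^ 2 * h2
  have hp0 : ∀ {p : ℕ}, p.Prime → (p : ℂ) ≠ 0 := fun hp => Nat.cast_ne_zero.mpr hp.ne_zero
  refine ⟨α, ?_, ?_, t, ?_, ?_⟩
  · -- normalized
    intro p hp j
    simp only [hα]
    rw [norm_mul, norm_natCast_cpow_of_pos hp.pos]
    have hpR : (0 : ℝ) < p := by exact_mod_cast hp.pos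
    have hb : ‖β p j‖ ≤ Real.sqrt p := by
      refine Real.le_sqrt_of_sq_le ?_
      exact hβnorm p hp j
    have hhalf : ((-(1 / 2 : ℂ))).re = -(1 / 2 : ℝ) := by simp
    rw [hhalf]
    calc ‖β p j‖ * (p : ℝ) ^ (-(1 / 2 : ℝ)) ≤ Real.sqrt p * (p : ℝ) ^ (-(1 / 2 : ℝ)) := by
          gcongr
      _ = 1 := by
          rw [Real.sqrt_eq_rpow, ← Real.rpow_add hpR]
          norm_num
  · -- the Euler product
    intro s hs
    have hs' : (3 / 2 : ℝ) < (s + 1 / 2).re := by simp; linarith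
    set f : ℕ → ℂ := fun n => LSeries.term (fun n => (W.LFunction n : ℂ)) (s + 1 / 2) n with hf
    have hf0 : f 0 = 0 := by simp [hf]
    have hL0 : (fun n => (W.LFunction n : ℂ)) 0 = 0 := by simp
    have hf1 : f 1 = 1 := by
      simp only [hf]
      rw [LSeries.term_def₀ hL0, W.LFunction_apply_one]
      simp
    have hmul : ∀ {m n : ℕ}, Nat.Coprime m n → f (m * n) = f m * f n := by
      intro m n hmn
      simp only [hf]
      rw [LSeries.term_def₀ hL0, LSeries.term_def₀ hL0, LSeries.term_def₀ hL0,
        (isMultiplicative_LFunction W).map_mul_of_coprime hmn, Int.cast_mul, Nat.cast_mul,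
        natCast_mul_natCast_cpow]
      ring
    have hsum' : Summable fun n => ‖f n‖ := (W.LSeriesSummable_of_lt_re_holds hs').norm
    have hE := EulerProduct.eulerProduct hf1 hmul hsum' hf0
    -- identify the local factors
    have hloc : ∀ (p : ℕ) (hp : p.Prime),
        ∑' e, f (p ^ e) = ∏ j, (1 - α p j * (p : ℂ) ^ (-s))⁻¹ := by
      intro p hp
      rw [(hEuler ⟨p, hp⟩ (s + 1 / 2) hs').tsum_eq, Finset.prod_inv_distrib]
      congr 1
      have hT : ∀ j, α p j * (p : ℂ) ^ (-s) = β p j * (p : ℂ) ^ (-(s + 1 / 2)) := by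
        intro j
        simp only [hα]
        rw [mul_assoc, ← cpow_add _ _ (hp0 hp)]
        ring_nf
      simp_rw [hT]
      rw [hfactor p hp]
    have hE' : Tendsto (fun n : ℕ => ∏ p ∈ Nat.primesBelow n, ∏ j, (1 - α p j * (p : ℂ) ^ (-s))⁻¹)
        atTop (𝓝 (W.LSeries (s + 1 / 2))) := by
      refine hE.congr fun n => ?_
      exact Finset.prod_congr rfl fun p hp => hloc p (Nat.prime_of_mem_primesBelow hp)
    -- pass to the real variable `x`, `primesLE x = primesBelow (⌊x⌋₊ + 1)`
    have hidx : Tendsto (fun x : ℝ => ⌊x⌋₊ + 1) atTop atTop :=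
      (tendsto_add_atTop_nat 1).comp (tendsto_nat_floor_atTop (α := ℝ))
    refine (hE'.comp hidx).congr fun x => ?_
    simp only [Function.comp_apply, partialProduct, Nat.primesLE]
  · -- `t_p > 0` and `c_p(1/2) = -log t_p`
    intro p hp
    have htp : t p = 1 - (A ⟨p, hp⟩ : ℝ) / p + B ⟨p, hp⟩ / (p : ℝ) ^ 2 := by simp [ht, dif_pos hp]
    have hpos' : 0 < t p := by rw [htp]; exact hpos ⟨p, hp⟩
    refine ⟨hpos', ?_⟩
    -- `∏_j (1 - α_{p,j} p^{-1/2}) = t_p`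
    have hprodt : ∏ j, (1 - α p j * (p : ℂ) ^ (-(1 / 2 : ℂ))) = (t p : ℂ) := by
      have hT : ∀ j, α p j * (p : ℂ) ^ (-(1 / 2 : ℂ)) = β p j * (p : ℂ) ^ (-1 : ℂ) := by
        intro j
        simp only [hα]
        rw [mul_assoc, ← cpow_add _ _ (hp0 hp)]
        norm_num
      simp_rw [hT]
      rw [hfactor p hp, htp, cpow_neg_one]
      push_cast
      field_simp
    -- the imaginary part of `c_p(1/2)` is small, so `c_p(1/2) = log (exp c_p(1/2)) = log (1/t_p)`
    have hne : ∀ j, α p j * (p : ℂ) ^ (-(1 / 2 : ℂ)) ≠ 1 := by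
      intro j h1
      have := norm_mul_cpow_neg_lt_one (d := 2) (α := α) ?_ hp j (s := 1 / 2) (by norm_num)
      · rw [h1, norm_one] at this; exact lt_irrefl _ this
      · intro q hq i
        -- normalization, as above
        simp only [hα]
        rw [norm_mul, norm_natCast_cpow_of_pos hq.pos]
        have hqR : (0 : ℝ) < q := by exact_mod_cast hq.pos
        have hb : ‖β q i‖ ≤ Real.sqrt q := Real.le_sqrt_of_sq_le (hβnorm q hq i)
        have hhalf : ((-(1 / 2 : ℂ))).re = -(1 / 2 : ℝ) := by simp
        rw [hhalf]
        calc ‖β q i‖ * (q : ℝ) ^ (-(1 / 2 : ℝ)) ≤ Real.sqrt q * (q : ℝ) ^ (-(1 / 2 : ℝ)) := by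
              gcongr
          _ = 1 := by rw [Real.sqrt_eq_rpow, ← Real.rpow_add hqR]; norm_num
    have hexp : exp (logEulerFactor α (1 / 2) p) = (t p : ℂ)⁻¹ := by
      rw [exp_logEulerFactor α hne, ← hprodt, Finset.prod_inv_distrib]
    have him : |(logEulerFactor α (1 / 2) p).im| < Real.pi := by
      rw [logEulerFactor, Fin.sum_univ_two]
      have harg : ∀ j, |(-log (1 - α p j * (p : ℂ) ^ (-(1 / 2 : ℂ)))).im| < Real.pi / 2 := by
        intro j
        rw [neg_im, abs_neg, log_im, Complex.abs_arg_lt_pi_div_two_iff]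
        left
        rw [sub_re, one_re, sub_pos]
        refine lt_of_le_of_lt (re_le_norm _) ?_
        have := norm_mul_cpow_neg_lt_one (d := 2) (α := α) ?_ hp j (s := 1 / 2) (by norm_num)
        · exact this
        · intro q hq i
          simp only [hα]
          rw [norm_mul, norm_natCast_cpow_of_pos hq.pos]
          have hqR : (0 : ℝ) < q := by exact_mod_cast hq.pos
          have hb : ‖β q i‖ ≤ Real.sqrt q := Real.le_sqrt_of_sq_le (hβnorm q hq i)
          have hhalf : ((-(1 / 2 : ℂ))).re = -(1 / 2 : ℝ) := by simp
          rw [hhalf]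
          calc ‖β q i‖ * (q : ℝ) ^ (-(1 / 2 : ℝ)) ≤ Real.sqrt q * (q : ℝ) ^ (-(1 / 2 : ℝ)) := by
                gcongr
            _ = 1 := by rw [Real.sqrt_eq_rpow, ← Real.rpow_add hqR]; norm_num
      rw [add_im]
      have h0 := harg 0
      have h1 := harg 1
      have := abs_add_le (-log (1 - α p 0 * (p : ℂ) ^ (-(1 / 2 : ℂ)))).im
        (-log (1 - α p 1 * (p : ℂ) ^ (-(1 / 2 : ℂ)))).im
      linarith
    have hlog : logEulerFactor α (1 / 2) p = log (exp (logEulerFactor α (1 / 2) p)) := by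
      rw [log_exp]
      · linarith [(abs_lt.mp him).1]
      · linarith [(abs_lt.mp him).2]
    rw [hlog, hexp, ← ofReal_inv, ← ofReal_log (inv_nonneg.mpr hpos'.le), Real.log_inv]
    push_cast
    ring
  · -- `t_p = N_p / p` outside the bad primes
    obtain ⟨S₀, hS₀⟩ : ∃ S₀ : Finset (HeightOneSpectrum (𝓞 ℚ)),
        ∀ v, ¬ W.HasGoodReductionAt v → v ∈ S₀ := by
      have hfin : (W.badPlaces (𝓞 ℚ)).Finite := W.finite_badPlaces_holds (𝓞 ℚ)
      exact ⟨hfin.toFinset, fun v hv => hfin.mem_toFinset.mpr hv⟩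
    refine ⟨S₀.image fun v => (primesEquiv v : ℕ), fun p hp hpS => ?_⟩
    have hgood : W.HasGoodReductionAt ((primesEquiv (R := 𝓞 ℚ)).symm ⟨p, hp⟩) := by
      by_contra hbad
      apply hpS
      refine Finset.mem_image.mpr ⟨_, hS₀ _ hbad, ?_⟩
      rw [Equiv.apply_symm_apply]
    have htp : t p = 1 - (A ⟨p, hp⟩ : ℝ) / p + B ⟨p, hp⟩ / (p : ℝ) ^ 2 := by simp [ht, dif_pos hp]
    rw [htp]
    exact hgoodcase ⟨p, hp⟩ hgood

end WeierstrassCurve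

end
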